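import Mathlib
import HarnessLib
import Summits.ResolutionOfSingularities.ResolutionOfSingularities.Theorems.WildQuotientsWildQuotientResolutionS1aKillOrAux
import Summits.ResolutionOfSingularities.ResolutionOfSingularities.Theorems.WildQuotientsWildQuotientResolutionS1aFrameWins

/-!
# S1a — `WinningStrategy p` FROM THE TWO-PHASE RULE (the `Theses`-cone wrapper of `…S1aKillOrAux`)

[OURS · L1 W4.5c · lead-1 g7; plan-1 ASSIGNMENT v10.5 (2)] — NOT statements of the manuscript; counted 0; AI-level work, weaker than expert
review. Crux stmt-ResolutionOfSingularities-17941, line `s1a-logminvertex` v6, registered stub `stub_winningStrategy`.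

* **`winningStrategy_of_killOrAuxRule`** — `KillOrAuxRule p → S1.FrameWins.WinningStrategy p` (`p` prime): the registered stub is CLOSED
  MODULO the two-phase OURS statement `KillOrAuxRule p` (weaker than `PrincipalCentreRule p`, weaker than `KillCentreRule p`).
* `winningStrategy_of_principalCentreRule`; `cyclicQuotientFourfolds_of_door_of_killOrAuxRule`, `…_of_berghRydh_of_killOrAuxRule`.
-/

set_option linter.dupNamespace false

noncomputable section

open CategoryTheory Limits AlgebraicGeometry TopologicalSpace
open Literature.AlgebraicGeometry.Resolution Literature.AlgebraicGeometry.RelativeSpec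
open Summit.ResolutionOfSingularities.ResolutionOfSingularities.Theorems.WildQuotientResolution.S1
open Summit.ResolutionOfSingularities.ResolutionOfSingularities.Theorems.WildQuotientResolution.S1.NodeAtlas
open Summit.ResolutionOfSingularities.ResolutionOfSingularities.Theorems.WildQuotientResolution.S1.GameFrame

namespace Summit.ResolutionOfSingularities.ResolutionOfSingularities.Theorems.WildQuotientResolution.S1

/-- **THE TERMINATION CRUX REDUCED TO THE TWO-PHASE RULE**: `KillOrAuxRule p → WinningStrategy p`. [OURS · L1 W4.5c] -/
theorem winningStrategy_of_killOrAuxRule {p : ℕ} (hp : p.Prime) (hrule : KillOrAuxRule p) : FrameWins.WinningStrategy p := by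
  intro k _ _ _ X' X₁ f q G _ _ ρ _ _ hfft hfqc _ _ _ hqfin _ _ hq _ _ _ g₀ hg₀ _ h₀
  haveI := hfft
  haveI := hfqc
  haveI := hqfin
  exact GModel.wins_initial_of_killOrAuxRule hp hrule f hg₀ hq h₀

/-- The one-phase (principal) rule also suffices. -/
theorem winningStrategy_of_principalCentreRule {p : ℕ} (hp : p.Prime) (hrule : PrincipalCentreRule p) :
    FrameWins.WinningStrategy p :=
  winningStrategy_of_killOrAuxRule hp (killOrAuxRule_of_principalCentreRule hrule)

/-- **Door + two-phase rule ⇒ the sub-crux `CyclicQuotientFourfolds`.** [OURS · L1 W4.5c] -/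
theorem cyclicQuotientFourfolds_of_door_of_killOrAuxRule (hD : FrameWins.DoorStatement)
    (hrule : ∀ p : ℕ, p.Prime → KillOrAuxRule p) :
    Summit.ResolutionOfSingularities.ResolutionOfSingularities.Theses.WildQuotients.CyclicQuotientFourfolds :=
  FrameWins.cyclicQuotientFourfolds_of_door_of_wins hD fun p hp _ => winningStrategy_of_killOrAuxRule hp (hrule p hp)

/-- **Modulo Bergh–Rydh (named fact) and the two-phase rule, the sub-crux holds.** [OURS · L1 W4.5c] -/
theorem cyclicQuotientFourfolds_of_berghRydh_of_killOrAuxRule (hBR : BerghRydh2019_diagonalizableQuotientResolution)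
    (hrule : ∀ p : ℕ, p.Prime → KillOrAuxRule p) :
    Summit.ResolutionOfSingularities.ResolutionOfSingularities.Theses.WildQuotients.CyclicQuotientFourfolds :=
  FrameWins.cyclicQuotientFourfolds_of_berghRydh_of_wins hBR fun p hp _ => winningStrategy_of_killOrAuxRule hp (hrule p hp)

end Summit.ResolutionOfSingularities.ResolutionOfSingularities.Theorems.WildQuotientResolution.S1

end
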